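import Literature.Barriers.ValiantsHypothesis.CKRST20NaturalProofsExist
import Literature.Barriers.ValiantsHypothesis.GKSS17FSVPresentation
import Literature.Computability.AlgebraicComplexity.HittingSetsExist
import Literature.Computability.AlgebraicComplexity.CircuitCount
import Literature.Computability.AlgebraicComplexity.RazElusiveGeneralRouteProofs
import Mathlib.FieldTheory.Finite.Extension
import Mathlib.LinearAlgebra.FiniteDimensional.Lemmas
import Mathlib.LinearAlgebra.Matrix.ToLin
import Mathlib.Algebra.MvPolynomial.SchwartzZippel
import HarnessLib

/-!
# CKRST 2020, Thm. 1.7 ("Thm 1.2", natural proofs for `VP` over finite fields) — discharge of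
# `CKRST2020_thm_1_2`

P. Chatterjee, M. Kumar, C. Ramya, R. Saptharishi, A. Tengse, *On the existence of algebraically
natural proofs*, FOCS 2020 (arXiv:2004.14147 v4 Thm. 1.7 = `MainThmFiniteFields`; proof = v4
Thm. 4.1 / v2 §3, "equations over a finite field"). The named fact `CKRST2020_thm_1_2 F` of
`CKRST20NaturalProofsExist.lean` is PROVED here (`CKRST2020_thm_1_2_holds`), following the printed
construction `P_N(z) = OR(z) · ∏_{a ∈ ℋ} ∏_i (1 - (Σ_m z_m · a^{m,(i)})^{|𝔽| - 1})`:

* **Extension field and hitting set.** For `d = n^c` let `K ⊇ 𝔽` be the extension of degree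
  `u = ⌊log_q (2d+1)⌋ + 1` (Mathlib's `FiniteField.Extension`; `|K| = q^u ≥ 2d + 1`, `q = |𝔽|`).
  A polynomial of degree `≤ d` and size `≤ s` over `𝔽` is one over `K` (`vpSlice` base change:
  extension of scalars does not increase the fan-in-two complexity), so the tree's hitting sets
  over `K` (`HittingSets.exists_hittingSet`, the Heintz–Schnorr-type existence theorem proved in
  the tree from the universal circuit and the Rónyai–Babai–Ganapathy count — in print [HS80] /
  v4 Lemma 3.8) give `ℋ ⊆ Kⁿ`, `|ℋ| = poly(n, d, s) · log |K|`, hitting every nonzero member of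
  `𝒞(n, d, s)`.
* **Linearisation.** For `a ∈ Kⁿ`, `f ↦ f(a)` is `𝔽`-linear in `coeff(f)`; its coordinates in an
  `𝔽`-basis of `K` are the `u` linear forms `L_{a,i}(z) = Σ_m (a^m)^{(i)} z_m`
  (`eval_coordForm`), and `f(a) = 0 ⟺ ∀ i, L_{a,i}(coeff f) = 0`.
* **The equation.** `P = OR(z) · ∏_{a ∈ ℋ} ∏_i (1 - L_{a,i}^{q-1})` vanishes at `coeff(f)` for every
  `f ∈ 𝒞(n,d,s)` (`f = 0` kills `OR`; otherwise some `L_{a,i}(coeff f) ≠ 0` and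
  `x^{q-1} = 1` on `𝔽ˣ` kills the product), has size and degree `poly(N, q, |ℋ|, u)`, and is nonzero
  at the coefficient vector of any nonzero `h` of degree `≤ d` vanishing on `ℋ`; such an `h` exists
  as soon as `u · |ℋ| < N = binom(n + d, n)` (a nonzero vector in the kernel of `u|ℋ|` linear forms
  on `𝔽^N`).
* **One family for every size exponent.** As in print (§4, "`s = n^{log n}`"), the family is built
  for the size schedule `s(n) = n^{⌊log₂ n⌋}`, which dominates every `n^k` eventually while
  `u · |ℋ|` stays `n^{O(log n)} < 2ⁿ ≤ N` (`threshold`).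

Deviations from print, all weakenings of what is used, none of what is stated: the hitting set is
the tree's (universal circuit + zero patterns) rather than [HS80]'s; `u` is the least admissible
extension degree rather than "a large enough extension"; constants in the size bound are explicit
(`e = 4`). No new definitions or named facts.

## References
* [ChatterjeeKumarRamyaSaptharishiTengse2020] arXiv:2004.14147 v4, Thm. 1.7 and Thm. 4.1 (v2 §3,
  locator paper:arxiv-2004.14147 p0005.txt:L37, p0010.txt:L19).
* [HeintzSchnorr1980] (the printed hitting set; here `HittingSets.exists_hittingSet`).
-/



noncomputable section

namespace Literature.Barriers.ValiantsHypothesis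

open Literature.Computability.AlgebraicComplexity MvPolynomial

namespace CKRST2020

namespace FiniteFields

/-! ### Extension of scalars does not increase complexity or degree -/

section MapLemmas

variable {k k' : Type*} [CommSemiring k] [CommSemiring k'] {σ : Type*}

/-- Mapping the coefficients does not increase the total degree. [folklore] -/
private theorem totalDegree_map_le (φ : k →+* k') (p : MvPolynomial σ k) :
    (MvPolynomial.map φ p).totalDegree ≤ p.totalDegree :=
  Finset.sup_mono (support_map_subset φ p)

end MapLemmas

/-- **Base change of CKRST's class `𝒞(n,d,s)`.** A polynomial of degree `≤ d` and size `≤ s`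
over `F` is one over any extension field `K` ("size" with constants from the larger field is at
most the size with constants from `F`).
[cite: ChatterjeeKumarRamyaSaptharishiTengse2020, v2 ‹Def 7› / Thm. 4.1 (proof)] -/
theorem map_mem_vpSlice {F K : Type*} [Field F] [Field K] [Algebra F K] {n d s : ℕ}
    {f : MvPolynomial (Fin n) F} (hf : f ∈ vpSlice F n d s) :
    MvPolynomial.map (algebraMap F K) f ∈ vpSlice K n d s :=
  ⟨(totalDegree_map_le _ f).trans hf.1, (ArithCircuit.complexity_map_le _ f).trans hf.2⟩

/-! ### Linearisation of evaluation at a point of an extension field -/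

section Linearisation

variable {F : Type*} [Field F] {K : Type*} [Field K] [Algebra F K] {ι : Type*} {n d : ℕ}

/-- **The coordinate linear forms `L_{a,i}`.** For a point `a ∈ Kⁿ`, an `F`-basis `b` of `K` and
a coordinate `i`: the linear form `z ↦ Σ_m (a^m)^{(i)} z_m` in the coefficient variables
`z_m, m ∈ x^{≤ d}`, where `(a^m)^{(i)}` is the `i`-th `b`-coordinate of the monomial value
`a^m = ∏_j a_j^{m_j}` — v4 Thm. 4.1's "`eval(a)^{(i)}`". Written as a term, not a definition.
[cite: ChatterjeeKumarRamyaSaptharishiTengse2020, Thm. 4.1 (arXiv v4), proof] -/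
theorem eval_coordForm_apply [Fintype (monomialsDegLE n d)] (b : Module.Basis ι F K) (a : Fin n → K)
    (i : ι) (v : monomialsDegLE n d → F) :
    eval v (∑ μ : monomialsDegLE n d,
        C (b.repr (∏ j, a j ^ (μ : Fin n →₀ ℕ) j) i) * X μ : MvPolynomial (monomialsDegLE n d) F) =
      ∑ μ : monomialsDegLE n d, b.repr (∏ j, a j ^ (μ : Fin n →₀ ℕ) j) i * v μ := by
  rw [map_sum]
  refine Finset.sum_congr rfl fun μ _ => ?_
  rw [map_mul, eval_C, eval_X]

/-- The support of a polynomial of degree `≤ d` lies in `x^{≤ d}`. [folklore] -/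
private theorem mem_monomialsDegLE_of_mem_support {R : Type*} [CommSemiring R]
    {f : MvPolynomial (Fin n) R} (hf : f.totalDegree ≤ d) {m : Fin n →₀ ℕ} (hm : m ∈ f.support) :
    m ∈ monomialsDegLE n d := by
  change m.degree ≤ d
  rw [Finsupp.degree_apply]
  exact (le_totalDegree hm).trans hf

/-- **Evaluation at `a ∈ Kⁿ` through the coefficient vector.** For `f` over `F` of degree `≤ d`:
`f(a) = Σ_{m ∈ x^{≤ d}} coeff_m(f) · a^m` in `K` (v4 Thm. 4.1: "`f(a) = ⟨coeff(f), eval(a)⟩`").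
[cite: ChatterjeeKumarRamyaSaptharishiTengse2020, Thm. 4.1 (arXiv v4), proof] -/
theorem eval_map_eq_sum_coeffVector [Fintype (monomialsDegLE n d)] (a : Fin n → K)
    {f : MvPolynomial (Fin n) F} (hf : f.totalDegree ≤ d) :
    eval a (MvPolynomial.map (algebraMap F K) f) =
      ∑ μ : monomialsDegLE n d, coeffVector (monomialsDegLE n d) f μ • ∏ j, a j ^ (μ : Fin n →₀ ℕ) j := by
  classical
  rw [eval_eq']
  -- enlarge the sum from the support of `map f` to the image of `x^{≤ d}`
  have hsub : (MvPolynomial.map (algebraMap F K) f).support ⊆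
      (Finset.univ : Finset (monomialsDegLE n d)).map (Function.Embedding.subtype _) := by
    intro m hm
    have hm' : m ∈ monomialsDegLE n d :=
      mem_monomialsDegLE_of_mem_support hf (support_map_subset _ _ hm)
    exact Finset.mem_map.mpr ⟨⟨m, hm'⟩, Finset.mem_univ _, rfl⟩
  rw [Finset.sum_subset hsub, Finset.sum_map]
  · refine Finset.sum_congr rfl fun μ _ => ?_
    rw [Function.Embedding.coe_subtype, coeff_map, coeffVector_apply, Algebra.smul_def]
  · intro m _ hm
    rw [notMem_support_iff.mp hm, zero_mul]

/-- **`L_{a,i}(coeff f)` is the `i`-th coordinate of `f(a)`** (the linearisation of v4 Thm. 4.1: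
"`f(a) = 0` if and only if `⟨coeff(f), eval(a)^{(i)}⟩ = 0` for every `i`").
[cite: ChatterjeeKumarRamyaSaptharishiTengse2020, Thm. 4.1 (arXiv v4), proof] -/
theorem eval_coordForm [Fintype (monomialsDegLE n d)] (b : Module.Basis ι F K) (a : Fin n → K) (i : ι)
    {f : MvPolynomial (Fin n) F} (hf : f.totalDegree ≤ d) :
    eval (coeffVector (monomialsDegLE n d) f) (∑ μ : monomialsDegLE n d,
        C (b.repr (∏ j, a j ^ (μ : Fin n →₀ ℕ) j) i) * X μ : MvPolynomial (monomialsDegLE n d) F) =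
      b.repr (eval a (MvPolynomial.map (algebraMap F K) f)) i := by
  rw [eval_coordForm_apply, eval_map_eq_sum_coeffVector a hf, map_sum, Finsupp.coe_finsetSum,
    Finset.sum_apply]
  refine Finset.sum_congr rfl fun μ _ => ?_
  rw [map_smul, Finsupp.smul_apply, smul_eq_mul, mul_comm]

/-- `f(a) = 0` iff all coordinate forms vanish at `coeff f`. [cite: ChatterjeeKumarRamyaSaptharishiTengse2020, Thm. 4.1 (arXiv v4), proof] -/
theorem eval_map_eq_zero_iff [Fintype (monomialsDegLE n d)] (b : Module.Basis ι F K) (a : Fin n → K)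
    {f : MvPolynomial (Fin n) F} (hf : f.totalDegree ≤ d) :
    eval a (MvPolynomial.map (algebraMap F K) f) = 0 ↔
      ∀ i, eval (coeffVector (monomialsDegLE n d) f) (∑ μ : monomialsDegLE n d,
        C (b.repr (∏ j, a j ^ (μ : Fin n →₀ ℕ) j) i) * X μ : MvPolynomial (monomialsDegLE n d) F) = 0 := by
  simp_rw [eval_coordForm b a _ hf]
  rw [← b.repr.map_eq_zero_iff, Finsupp.ext_iff]
  simp only [Finsupp.zero_apply]

end Linearisation

/-! ### Size and degree bookkeeping for the construction -/

section Bookkeeping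

variable {k : Type*} [CommRing k] {σ : Type*}

/-- `L(x^m) ≤ m (L(x) + 1)` (repeated multiplication). [folklore] -/
private theorem complexity_pow_le (x : MvPolynomial σ k) (m : ℕ) :
    complexity (x ^ m) ≤ m * (complexity x + 1) := by
  induction m with
  | zero => rw [pow_zero, ← C_1, complexity_C_holds]; exact Nat.zero_le _
  | succ m ih =>
    rw [pow_succ]
    calc complexity (x ^ m * x) ≤ complexity (x ^ m) + complexity x + 1 :=
          complexity_mul_le_holds _ _
      _ ≤ m * (complexity x + 1) + complexity x + 1 := by omega
      _ = (m + 1) * (complexity x + 1) := by ring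

/-- `L(1 - x) ≤ L(x) + 2` (`1 - x = C 1 + (-1) • x`). [folklore] -/
private theorem complexity_one_sub_le (x : MvPolynomial σ k) : complexity (1 - x) ≤ complexity x + 2 := by
  have h : (1 - x : MvPolynomial σ k) = C 1 + (-1 : k) • x := by
    rw [neg_one_smul, C_1, sub_eq_add_neg]
  rw [h]
  calc complexity (C 1 + (-1 : k) • x) ≤ complexity (C (1 : k) : MvPolynomial σ k) +
        complexity ((-1 : k) • x) + 1 := complexity_add_le_holds _ _
    _ ≤ 0 + (complexity x + 1) + 1 := by
        rw [complexity_C_holds]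
        exact Nat.add_le_add_right (Nat.add_le_add_left (complexity_smul_le_holds _ _) _) _
    _ = complexity x + 2 := by ring

/-- A linear form `Σ_μ c_μ z_μ` has complexity `≤ 2 N`. [folklore] -/
private theorem complexity_linearForm_le {M : Type*} [Fintype M] (coef : M → k) :
    complexity (∑ μ : M, C (coef μ) * X μ : MvPolynomial M k) ≤ 2 * Fintype.card M := by
  calc complexity (∑ μ : M, C (coef μ) * X μ : MvPolynomial M k)
      ≤ ∑ μ : M, complexity (C (coef μ) * X μ : MvPolynomial M k) + Finset.univ.card :=
        complexity_finset_sum_le _ _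
    _ ≤ ∑ _μ : M, 1 + Finset.univ.card := by
        refine Nat.add_le_add_right (Finset.sum_le_sum fun μ _ => ?_) _
        calc complexity (C (coef μ) * X μ : MvPolynomial M k)
            ≤ complexity (C (coef μ) : MvPolynomial M k) + complexity (X μ : MvPolynomial M k) + 1 :=
              complexity_mul_le_holds _ _
          _ = 1 := by rw [complexity_C_holds, complexity_X_holds]
    _ = 2 * Fintype.card M := by rw [Finset.sum_const, smul_eq_mul, mul_one, Finset.card_univ]; ring

/-- A linear form has total degree `≤ 1`. [folklore] -/
private theorem totalDegree_linearForm_le [Nontrivial k] {M : Type*} [Fintype M] (coef : M → k) :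
    (∑ μ : M, C (coef μ) * X μ : MvPolynomial M k).totalDegree ≤ 1 := by
  refine totalDegree_finsetSum_le fun μ _ => ?_
  calc (C (coef μ) * X μ : MvPolynomial M k).totalDegree
      ≤ (C (coef μ) : MvPolynomial M k).totalDegree + (X μ : MvPolynomial M k).totalDegree :=
        totalDegree_mul _ _
    _ ≤ 0 + 1 := by
        rw [totalDegree_C]
        exact Nat.add_le_add_left (totalDegree_X _).le _
    _ = 1 := rfl

/-- `deg (1 - x) ≤ deg x`. [folklore] -/
private theorem totalDegree_one_sub_le (x : MvPolynomial σ k) : (1 - x).totalDegree ≤ x.totalDegree := by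
  refine (totalDegree_sub _ _).trans (max_le ?_ le_rfl)
  rw [totalDegree_one]; exact Nat.zero_le _

/-- `deg (x^m) ≤ m · deg x`. [folklore] -/
private theorem totalDegree_pow_le (x : MvPolynomial σ k) (m : ℕ) : (x ^ m).totalDegree ≤ m * x.totalDegree :=
  totalDegree_pow _ _

end Bookkeeping

/-! ### Fermat's little theorem as an indicator -/

section Indicator

variable {F : Type*} [Field F] [Fintype F] [DecidableEq F]

/-- `x^{q-1} = [x ≠ 0]` in a finite field with `q` elements. [folklore] -/
private theorem pow_card_sub_one_eq_ite (x : F) :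
    x ^ (Fintype.card F - 1) = if x = 0 then 0 else 1 := by
  split_ifs with hx
  · rw [hx, zero_pow]
    have := Fintype.one_lt_card (α := F)
    omega
  · exact FiniteField.pow_card_sub_one_eq_one x hx

/-- `1 - x^{q-1} = [x = 0]`. [cite: ChatterjeeKumarRamyaSaptharishiTengse2020, Thm. 4.1 (arXiv v4), proof] -/
private theorem one_sub_pow_card_sub_one (x : F) :
    1 - x ^ (Fintype.card F - 1) = if x = 0 then 1 else 0 := by
  rw [pow_card_sub_one_eq_ite]
  split_ifs <;> simp

end Indicator

/-! ### The equation `P = OR(z) · ∏_{a ∈ ℋ} ∏_i (1 - L_{a,i}^{q-1})` -/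

section Equation

variable {F : Type*} [Field F] [Fintype F] {K : Type*} [Field K] [Algebra F K] [FiniteDimensional F K]
  {n d : ℕ}

/-- **The equation of v4 Thm. 4.1 for a given hitting set.** For a finite `ℋ ⊆ Kⁿ` (`K ⊇ F`
finite-dimensional, `r = [K : F]`, `q = |F|`, `N = |x^{≤ d}|`) there is a polynomial `P(z)` in the
`N` coefficient variables over `F` with: `L(P) ≤ 8 q N (r|ℋ| + 1)`, `deg P ≤ q (N + r|ℋ|)`;
`P(coeff f) = 0` for every `f` of degree `≤ d` that is zero or does not vanish identically on `ℋ`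
(as a polynomial over `K`); and, if `r |ℋ| < N`, some `h` of degree `≤ d` with `P(coeff h) ≠ 0`
(a nonzero `h` vanishing on `ℋ`). This is `P = OR(z) · ∏_{a ∈ ℋ} ∏_i (1 - L_{a,i}^{q-1})` with
`OR(z) = 1 - ∏_m (1 - z_m^{q-1})`. [cite: ChatterjeeKumarRamyaSaptharishiTengse2020, Thm. 4.1 (arXiv v4) = v2 §3, proof] -/
theorem exists_equation [Fintype (monomialsDegLE n d)] (H : Finset (Fin n → K)) :
    ∃ P : MvPolynomial (monomialsDegLE n d) F,
      complexity P ≤ 8 * Fintype.card F * Fintype.card (monomialsDegLE n d) *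
          (Module.finrank F K * H.card + 1) ∧
      P.totalDegree ≤ Fintype.card F * (Fintype.card (monomialsDegLE n d) + Module.finrank F K * H.card) ∧
      (∀ f : MvPolynomial (Fin n) F, f.totalDegree ≤ d →
        (f ≠ 0 → ∃ a ∈ H, eval a (MvPolynomial.map (algebraMap F K) f) ≠ 0) →
        eval (coeffVector (monomialsDegLE n d) f) P = 0) ∧
      (Module.finrank F K * H.card < Fintype.card (monomialsDegLE n d) →
        ∃ h : MvPolynomial (Fin n) F, h.totalDegree ≤ d ∧
          eval (coeffVector (monomialsDegLE n d) h) P ≠ 0) := by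
  classical
  -- notation
  set q := Fintype.card F with hq
  set N := Fintype.card (monomialsDegLE n d) with hN
  set r := Module.finrank F K with hr
  let b := Module.finBasis F K
  -- the coordinate linear forms `L a i`
  let L : (Fin n → K) → Fin r → MvPolynomial (monomialsDegLE n d) F := fun a i =>
    ∑ μ : monomialsDegLE n d, C (b.repr (∏ j, a j ^ (μ : Fin n →₀ ℕ) j) i) * X μ
  -- the indicator of "f vanishes on ℋ" and the OR polynomial
  let Q : MvPolynomial (monomialsDegLE n d) F := ∏ a ∈ H, ∏ i : Fin r, (1 - L a i ^ (q - 1))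
  let O : MvPolynomial (monomialsDegLE n d) F :=
    1 - ∏ μ : monomialsDegLE n d, (1 - (X μ : MvPolynomial (monomialsDegLE n d) F) ^ (q - 1))
  have hq1 : 1 ≤ q := Fintype.card_pos
  have hN1 : 1 ≤ N := Fintype.card_pos_iff.mpr ⟨⟨0, by change Finsupp.degree _ ≤ d; simp⟩⟩
  -- complexity bookkeeping
  have hL : ∀ a i, complexity (L a i) ≤ 2 * N := fun a i => complexity_linearForm_le _
  have hfac : ∀ a i, complexity (1 - L a i ^ (q - 1)) ≤ 5 * q * N := by
    intro a i
    calc complexity (1 - L a i ^ (q - 1)) ≤ complexity (L a i ^ (q - 1)) + 2 := complexity_one_sub_le _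
      _ ≤ (q - 1) * (complexity (L a i) + 1) + 2 := Nat.add_le_add_right (complexity_pow_le _ _) _
      _ ≤ q * (2 * N + 1) + 2 := by
          have := hL a i
          exact Nat.add_le_add_right (Nat.mul_le_mul (Nat.sub_le _ _) (by omega)) _
      _ ≤ 5 * q * N := by nlinarith
  have hQ : complexity Q ≤ H.card * (r * (5 * q * N + 1)) + H.card := by
    calc complexity Q ≤ ∑ a ∈ H, complexity (∏ i : Fin r, (1 - L a i ^ (q - 1))) + H.card :=
          complexity_finset_prod_le _ _
      _ ≤ ∑ _a ∈ H, r * (5 * q * N + 1) + H.card := by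
          refine Nat.add_le_add_right (Finset.sum_le_sum fun a _ => ?_) _
          calc complexity (∏ i : Fin r, (1 - L a i ^ (q - 1)))
              ≤ ∑ i : Fin r, complexity (1 - L a i ^ (q - 1)) + Finset.univ.card :=
                complexity_finset_prod_le _ _
            _ ≤ ∑ _i : Fin r, 5 * q * N + Finset.univ.card :=
                Nat.add_le_add_right (Finset.sum_le_sum fun i _ => hfac a i) _
            _ = r * (5 * q * N + 1) := by
                rw [Finset.sum_const, smul_eq_mul, Finset.card_univ, Fintype.card_fin]; ring
      _ = H.card * (r * (5 * q * N + 1)) + H.card := by rw [Finset.sum_const, smul_eq_mul]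
  have hO : complexity O ≤ 5 * q * N := by
    calc complexity O ≤ complexity (∏ μ : monomialsDegLE n d,
          (1 - (X μ : MvPolynomial (monomialsDegLE n d) F) ^ (q - 1))) + 2 := complexity_one_sub_le _
      _ ≤ (∑ μ : monomialsDegLE n d, complexity
            (1 - (X μ : MvPolynomial (monomialsDegLE n d) F) ^ (q - 1)) + Finset.univ.card) + 2 :=
          Nat.add_le_add_right (complexity_finset_prod_le _ _) _
      _ ≤ (∑ _μ : monomialsDegLE n d, (q + 1) + Finset.univ.card) + 2 := by
          refine Nat.add_le_add_right (Nat.add_le_add_right (Finset.sum_le_sum fun μ _ => ?_) _) _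
          calc complexity (1 - (X μ : MvPolynomial (monomialsDegLE n d) F) ^ (q - 1))
              ≤ complexity ((X μ : MvPolynomial (monomialsDegLE n d) F) ^ (q - 1)) + 2 :=
                complexity_one_sub_le _
            _ ≤ (q - 1) * (complexity (X μ : MvPolynomial (monomialsDegLE n d) F) + 1) + 2 :=
                Nat.add_le_add_right (complexity_pow_le _ _) _
            _ ≤ q + 1 := by rw [complexity_X_holds]; omega
      _ = N * (q + 1) + N + 2 := by rw [Finset.sum_const, smul_eq_mul, Finset.card_univ]
      _ ≤ 5 * q * N := by nlinarith
  -- degree bookkeeping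
  have hLd : ∀ a i, (L a i).totalDegree ≤ 1 := fun a i => totalDegree_linearForm_le _
  have hfacd : ∀ a i, (1 - L a i ^ (q - 1)).totalDegree ≤ q := by
    intro a i
    calc (1 - L a i ^ (q - 1)).totalDegree ≤ (L a i ^ (q - 1)).totalDegree := totalDegree_one_sub_le _
      _ ≤ (q - 1) * (L a i).totalDegree := totalDegree_pow_le _ _
      _ ≤ (q - 1) * 1 := Nat.mul_le_mul_left _ (hLd a i)
      _ ≤ q := by omega
  have hQd : Q.totalDegree ≤ q * (r * H.card) := by
    calc Q.totalDegree ≤ ∑ a ∈ H, (∏ i : Fin r, (1 - L a i ^ (q - 1))).totalDegree :=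
          totalDegree_finsetProd _ _
      _ ≤ ∑ _a ∈ H, r * q := by
          refine Finset.sum_le_sum fun a _ => ?_
          calc (∏ i : Fin r, (1 - L a i ^ (q - 1))).totalDegree
              ≤ ∑ i : Fin r, (1 - L a i ^ (q - 1)).totalDegree := totalDegree_finsetProd _ _
            _ ≤ ∑ _i : Fin r, q := Finset.sum_le_sum fun i _ => hfacd a i
            _ = r * q := by rw [Finset.sum_const, smul_eq_mul, Finset.card_univ, Fintype.card_fin]
      _ = q * (r * H.card) := by rw [Finset.sum_const, smul_eq_mul]; ring
  have hOd : O.totalDegree ≤ q * N := by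
    calc O.totalDegree ≤ (∏ μ : monomialsDegLE n d,
          (1 - (X μ : MvPolynomial (monomialsDegLE n d) F) ^ (q - 1))).totalDegree :=
          totalDegree_one_sub_le _
      _ ≤ ∑ μ : monomialsDegLE n d,
          (1 - (X μ : MvPolynomial (monomialsDegLE n d) F) ^ (q - 1)).totalDegree :=
          totalDegree_finsetProd _ _
      _ ≤ ∑ _μ : monomialsDegLE n d, q := by
          refine Finset.sum_le_sum fun μ _ => ?_
          calc (1 - (X μ : MvPolynomial (monomialsDegLE n d) F) ^ (q - 1)).totalDegree
              ≤ ((X μ : MvPolynomial (monomialsDegLE n d) F) ^ (q - 1)).totalDegree :=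
                totalDegree_one_sub_le _
            _ ≤ (q - 1) * (X μ : MvPolynomial (monomialsDegLE n d) F).totalDegree := totalDegree_pow_le _ _
            _ ≤ (q - 1) * 1 := Nat.mul_le_mul_left _ (totalDegree_X _).le
            _ ≤ q := by omega
      _ = q * N := by rw [Finset.sum_const, smul_eq_mul, Finset.card_univ]; ring
  -- evaluation of the indicator and of OR
  have evalQ_one : ∀ v : monomialsDegLE n d → F, (∀ a ∈ H, ∀ i, eval v (L a i) = 0) → eval v Q = 1 := by
    intro v hv
    rw [map_prod]
    refine Finset.prod_eq_one fun a ha => ?_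
    rw [map_prod]
    refine Finset.prod_eq_one fun i _ => ?_
    rw [map_sub, map_one, map_pow, one_sub_pow_card_sub_one, if_pos (hv a ha i)]
  have evalQ_zero : ∀ v : monomialsDegLE n d → F, (∃ a ∈ H, ∃ i, eval v (L a i) ≠ 0) → eval v Q = 0 := by
    rintro v ⟨a, ha, i, hi⟩
    rw [map_prod]
    refine Finset.prod_eq_zero ha ?_
    rw [map_prod]
    refine Finset.prod_eq_zero (Finset.mem_univ i) ?_
    rw [map_sub, map_one, map_pow, one_sub_pow_card_sub_one, if_neg hi]
  have evalO_zero : eval (0 : monomialsDegLE n d → F) O = 0 := by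
    have h1 : eval (0 : monomialsDegLE n d → F) (∏ μ : monomialsDegLE n d,
        (1 - (X μ : MvPolynomial (monomialsDegLE n d) F) ^ (q - 1))) = 1 := by
      rw [map_prod]
      refine Finset.prod_eq_one fun μ _ => ?_
      rw [map_sub, map_one, map_pow, eval_X, Pi.zero_apply, one_sub_pow_card_sub_one, if_pos rfl]
    change eval 0 (1 - _) = 0
    rw [map_sub, map_one, h1, sub_self]
  have evalO_one : ∀ v : monomialsDegLE n d → F, v ≠ 0 → eval v O = 1 := by
    intro v hv
    obtain ⟨μ₀, hμ₀⟩ := Function.ne_iff.mp hv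
    have hμ₀' : v μ₀ ≠ 0 := hμ₀
    have h1 : eval v (∏ μ : monomialsDegLE n d,
        (1 - (X μ : MvPolynomial (monomialsDegLE n d) F) ^ (q - 1))) = 0 := by
      rw [map_prod]
      refine Finset.prod_eq_zero (Finset.mem_univ μ₀) ?_
      rw [map_sub, map_one, map_pow, eval_X, one_sub_pow_card_sub_one, if_neg hμ₀']
    change eval v (1 - _) = 1
    rw [map_sub, map_one, h1, sub_zero]
  -- the equation
  refine ⟨O * Q, ?_, ?_, ?_, ?_⟩
  · -- complexity
    have hr1 : 1 ≤ r := Module.finrank_pos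
    have h1 : H.card ≤ r * H.card := Nat.le_mul_of_pos_left _ hr1
    have h2 : 1 ≤ q * N := Nat.le_of_lt_succ (by nlinarith)
    calc complexity (O * Q) ≤ complexity O + complexity Q + 1 := complexity_mul_le_holds _ _
      _ ≤ 5 * q * N + (H.card * (r * (5 * q * N + 1)) + H.card) + 1 := by
          gcongr
      _ ≤ 5 * q * N + (H.card * (r * (5 * q * N + 1)) + r * H.card) + q * N := by
          gcongr
      _ = 6 * (q * N) + r * H.card * (5 * (q * N) + 2) := by ring
      _ ≤ 8 * (q * N) + r * H.card * (8 * (q * N)) := by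
          have : 5 * (q * N) + 2 ≤ 8 * (q * N) := by omega
          gcongr
          norm_num
      _ = 8 * q * N * (r * H.card + 1) := by ring
  · -- degree
    calc (O * Q).totalDegree ≤ O.totalDegree + Q.totalDegree := totalDegree_mul _ _
      _ ≤ q * N + q * (r * H.card) := Nat.add_le_add hOd hQd
      _ = q * (N + r * H.card) := by ring
  · -- vanishing on the class
    intro f hfd hhit
    rw [map_mul]
    by_cases hf0 : f = 0
    · have hv : coeffVector (monomialsDegLE n d) f = 0 := by
        funext μ; rw [coeffVector_apply, hf0, coeff_zero, Pi.zero_apply]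
      rw [hv, evalO_zero, zero_mul]
    · obtain ⟨a, ha, hne⟩ := hhit hf0
      obtain ⟨i, hi⟩ : ∃ i, eval (coeffVector (monomialsDegLE n d) f) (L a i) ≠ 0 := by
        by_contra hcon
        push Not at hcon
        exact hne ((eval_map_eq_zero_iff b a hfd).mpr hcon)
      rw [evalQ_zero _ ⟨a, ha, i, hi⟩, mul_zero]
  · -- the witness
    intro hlt
    -- a nonzero coefficient vector in the kernel of all `L a i`, `a ∈ ℋ`
    let A : Matrix (H × Fin r) (monomialsDegLE n d) F := fun ai μ =>
      b.repr (∏ j, (ai.1 : Fin n → K) j ^ (μ : Fin n →₀ ℕ) j) ai.2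
    have hker : LinearMap.ker (Matrix.toLin' A) ≠ ⊥ := by
      apply LinearMap.ker_ne_bot_of_finrank_lt
      rw [Module.finrank_fintype_fun_eq_card, Module.finrank_fintype_fun_eq_card,
        Fintype.card_prod, Fintype.card_coe, Fintype.card_fin]
      rw [mul_comm]; exact hlt
    obtain ⟨v, hvker, hv0⟩ := (Submodule.ne_bot_iff _).mp hker
    have hvL : ∀ a ∈ H, ∀ i, eval v (L a i) = 0 := by
      intro a ha i
      have h := congrFun (LinearMap.mem_ker.mp hvker) (⟨a, ha⟩, i)
      rw [Matrix.toLin'_apply, Pi.zero_apply, Matrix.mulVec, dotProduct] at h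
      rw [eval_coordForm_apply]
      exact h
    -- the polynomial with that coefficient vector
    let h : MvPolynomial (Fin n) F := ∑ μ : monomialsDegLE n d, monomial (μ : Fin n →₀ ℕ) (v μ)
    have hcoeff : coeffVector (monomialsDegLE n d) h = v := by
      funext μ₀
      rw [coeffVector_apply, coeff_sum]
      simp_rw [coeff_monomial]
      rw [Finset.sum_eq_single μ₀]
      · rw [if_pos rfl]
      · intro μ _ hne
        rw [if_neg (fun h => hne (Subtype.ext h))]
      · intro h; exact absurd (Finset.mem_univ _) h
    have hdeg : h.totalDegree ≤ d := by
      refine totalDegree_finsetSum_le fun μ _ => ?_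
      refine (totalDegree_monomial_le _ _).trans ?_
      have hμ : (μ : Fin n →₀ ℕ).degree ≤ d := μ.2
      rw [Finsupp.degree_apply] at hμ
      exact hμ
    refine ⟨h, hdeg, ?_⟩
    rw [hcoeff, map_mul, evalO_one v hv0, evalQ_one v hvL, one_mul]
    exact one_ne_zero

end Equation

/-! ### Arithmetic: the threshold `u · |ℋ| < N` for the schedule `s = n^{⌊log₂ n⌋}` -/

section Threshold

/-- `a ≤ 2^x`, `b ≤ 2^y` ⇒ `ab ≤ 2^(x+y)`. [folklore] -/
private theorem mul_le_two_pow {a b x y : ℕ} (ha : a ≤ 2 ^ x) (hb : b ≤ 2 ^ y) :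
    a * b ≤ 2 ^ (x + y) := by
  rw [pow_add]; exact Nat.mul_le_mul ha hb

/-- `a, b ≤ 2^x` ⇒ `a + b ≤ 2^(x+1)`. [folklore] -/
private theorem add_le_two_pow {a b x : ℕ} (ha : a ≤ 2 ^ x) (hb : b ≤ 2 ^ x) :
    a + b ≤ 2 ^ (x + 1) := by
  rw [pow_succ]; omega

/-- `a ≤ 2^x` ⇒ `a + 1 ≤ 2^(x+1)`. [folklore] -/
private theorem succ_le_two_pow {a x : ℕ} (ha : a ≤ 2 ^ x) : a + 1 ≤ 2 ^ (x + 1) := by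
  have := Nat.one_le_two_pow (n := x)
  rw [pow_succ]; omega

/-- `a ≤ 2^x` ⇒ `a^k ≤ 2^(x k)`. [folklore] -/
private theorem pow_le_two_pow {a x : ℕ} (ha : a ≤ 2 ^ x) (k : ℕ) : a ^ k ≤ 2 ^ (x * k) := by
  rw [pow_mul]; exact Nat.pow_le_pow_left ha k

/-- Monotonicity of `2^x`. [folklore] -/
private theorem two_pow_mono {x y : ℕ} (h : x ≤ y) : 2 ^ x ≤ 2 ^ y :=
  Nat.pow_le_pow_right (by norm_num) h

/-- `x + 5 ≤ 2^(x+3)`. [folklore] -/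
private theorem add_five_le_two_pow (x : ℕ) : x + 5 ≤ 2 ^ (x + 3) := by
  have := @Nat.lt_two_pow_self x
  rw [pow_add]; norm_num; omega

/-- `2^n ≤ C(2n, n)`. [folklore] -/
private theorem two_pow_le_centralBinom (n : ℕ) : 2 ^ n ≤ (2 * n).choose n := by
  induction n with
  | zero => simp
  | succ n ih =>
    have h1 : (2 * (n + 1)).choose (n + 1) =
        (2 * n + 1).choose n + (2 * n + 1).choose (n + 1) := by
      rw [show 2 * (n + 1) = (2 * n + 1) + 1 by ring, Nat.choose_succ_succ]
    have h2 : (2 * n + 1).choose (n + 1) = (2 * n + 1).choose n := Nat.choose_symm_half n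
    have h3 : (2 * n).choose n ≤ (2 * n + 1).choose n := Nat.choose_le_succ _ _
    rw [h1, h2, pow_succ]; omega

/-- `L³ ≤ 2^L` for `L ≥ 10`. [folklore] -/
private theorem cube_le_two_pow {L : ℕ} (hL : 10 ≤ L) : L ^ 3 ≤ 2 ^ L := by
  induction L, hL using Nat.le_induction with
  | base => norm_num
  | succ L hL ih =>
    have h10 : 10 * L ^ 2 ≤ L ^ 3 := by
      calc 10 * L ^ 2 ≤ L * L ^ 2 := Nat.mul_le_mul_right _ hL
        _ = L ^ 3 := by ring
    have h1 : 3 * L ^ 2 + 3 * L + 1 ≤ L ^ 3 := by nlinarith [h10, hL]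
    calc (L + 1) ^ 3 = L ^ 3 + (3 * L ^ 2 + 3 * L + 1) := by ring
      _ ≤ L ^ 3 + L ^ 3 := Nat.add_le_add_left h1 _
      _ = 2 * L ^ 3 := by ring
      _ ≤ 2 * 2 ^ L := Nat.mul_le_mul_left _ ih
      _ = 2 ^ (L + 1) := (pow_succ' 2 L).symm

/-- Eventually `A (L+1)² + B < 2^L`. [folklore] -/
private theorem eventually_quad_lt_two_pow (A B : ℕ) :
    ∃ L₀, ∀ L, L₀ ≤ L → A * (L + 1) ^ 2 + B < 2 ^ L := by
  refine ⟨max 10 (4 * A + B + 1), fun L hL => ?_⟩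
  have h10 : 10 ≤ L := le_of_max_le_left hL
  have hC : 4 * A + B + 1 ≤ L := le_of_max_le_right hL
  have h1 : A * (L + 1) ^ 2 + B < (4 * A + B + 1) * L ^ 2 := by nlinarith
  calc A * (L + 1) ^ 2 + B < (4 * A + B + 1) * L ^ 2 := h1
    _ ≤ L * L ^ 2 := Nat.mul_le_mul_right _ hC
    _ = L ^ 3 := by ring
    _ ≤ 2 ^ L := cube_le_two_pow h10

/-- `n, n^c, n^{⌊log₂ n⌋} ≤ 2^E` for `E = (c+1)(⌊log₂ n⌋+1)²`. [folklore] -/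
private theorem basic_le (c n : ℕ) :
    n ≤ 2 ^ ((c + 1) * (Nat.log 2 n + 1) ^ 2) ∧
      n ^ c ≤ 2 ^ ((c + 1) * (Nat.log 2 n + 1) ^ 2) ∧
      n ^ Nat.log 2 n ≤ 2 ^ ((c + 1) * (Nat.log 2 n + 1) ^ 2) := by
  set L := Nat.log 2 n with hL
  have hsq : L + 1 ≤ (L + 1) ^ 2 := Nat.le_self_pow (by norm_num) _
  have h3 : (L + 1) ^ 2 ≤ (c + 1) * (L + 1) ^ 2 := Nat.le_mul_of_pos_left _ (Nat.succ_pos c)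
  have e1 : c * (L + 1) ≤ (c + 1) * (L + 1) ^ 2 := Nat.mul_le_mul (Nat.le_succ c) hsq
  have e2 : L * (L + 1) ≤ (c + 1) * (L + 1) ^ 2 := by
    calc L * (L + 1) ≤ (L + 1) * (L + 1) := Nat.mul_le_mul_right _ (Nat.le_succ L)
      _ = (L + 1) ^ 2 := (pow_two _).symm
      _ ≤ (c + 1) * (L + 1) ^ 2 := h3
  have hn : n ≤ 2 ^ (L + 1) := (Nat.lt_pow_succ_log_self (by norm_num) n).le
  refine ⟨hn.trans (two_pow_mono (hsq.trans h3)), ?_, ?_⟩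
  · exact (pow_le_two_pow hn c).trans (two_pow_mono (by rw [mul_comm]; exact e1))
  · exact (pow_le_two_pow hn L).trans (two_pow_mono (by rw [mul_comm]; exact e2))

/-- **The threshold.** For `q ≥ 2`, `c ≥ 1` and `n ≥ n₀(q, c)`: with `d = n^c`,
`s = n^{⌊log₂ n⌋}`, `u = ⌊log_q (2d+1)⌋ + 1`, `B = 9376 (n+d+s+2)^{26} (⌊log₂((q^u)^n (3d+1) + 1)⌋ + 1) + 1`
(the size of the hitting set over the degree-`u` extension) and `N = binom(n + d, n)`:
`u · B < N` and `8 q ≤ N` (everything on the left is `2^{O((c+1) log² n + log q)}`, while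
`N ≥ 2ⁿ`). [cite: ChatterjeeKumarRamyaSaptharishiTengse2020, §4 ("s = n^{log n}"; remark on largeness)] -/
theorem threshold (q c : ℕ) (hq : 2 ≤ q) (hc : 1 ≤ c) : ∃ n₀ : ℕ, ∀ n, n₀ ≤ n →
    (Nat.log q (2 * n ^ c + 1) + 1) *
        (9376 * (n + n ^ c + n ^ Nat.log 2 n + 2) ^ 26 *
          (Nat.log 2 ((q ^ (Nat.log q (2 * n ^ c + 1) + 1)) ^ n * (3 * n ^ c + 1) + 1) + 1) + 1) <
      (n + n ^ c).choose n ∧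
    8 * q ≤ (n + n ^ c).choose n := by
  set lq := Nat.log 2 q + 1 with hlq
  have hqlq : q ≤ 2 ^ lq := (Nat.lt_pow_succ_log_self (by norm_num) q).le
  obtain ⟨L₀, hL₀⟩ := eventually_quad_lt_two_pow (29 * (c + 1)) (lq + 74)
  refine ⟨2 ^ max L₀ 1, fun n hn => ?_⟩
  set L := Nat.log 2 n with hLdef
  set E := (c + 1) * (L + 1) ^ 2 with hEdef
  have hn1 : 1 ≤ n := le_trans Nat.one_le_two_pow hn
  have hL0 : L₀ ≤ L := by
    rw [hLdef]
    exact le_trans (le_max_left _ _) (Nat.le_log_of_pow_le (by norm_num) hn)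
  have hkey : 29 * (c + 1) * (L + 1) ^ 2 + (lq + 74) < 2 ^ L := hL₀ L hL0
  have hpowL : 2 ^ L ≤ n := by rw [hLdef]; exact Nat.pow_log_le_self 2 (by omega)
  have hE1 : 1 ≤ E := by rw [hEdef]; nlinarith
  have h2E : 2 ≤ 2 ^ E := by
    calc (2 : ℕ) = 2 ^ 1 := (pow_one 2).symm
      _ ≤ 2 ^ E := two_pow_mono hE1
  obtain ⟨hnE, hdE, hsE⟩ := basic_le c n
  rw [← hLdef, ← hEdef] at hnE hdE hsE
  set d := n ^ c with hd
  set u := Nat.log q (2 * d + 1) + 1 with hu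
  -- u ≤ E + 4 ≤ 2^(E+3)
  have hu_le : u ≤ E + 4 := by
    have h1 : Nat.log q (2 * d + 1) ≤ Nat.log 2 (2 * d + 1) := Nat.log_anti_left (by norm_num) hq
    have h2 : Nat.log 2 (2 * d + 1) < E + 3 := by
      rw [Nat.log_lt_iff_lt_pow (by norm_num) (by omega)]
      calc 2 * d + 1 ≤ 2 * 2 ^ E + 2 ^ E := by have := Nat.one_le_two_pow (n := E); omega
        _ < 2 ^ (E + 3) := by rw [pow_add]; norm_num; omega
    omega
  have hu_pow : u ≤ 2 ^ (E + 3) := hu_le.trans (by have := add_five_le_two_pow E; omega)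
  -- the argument of the logarithm
  have hqun : (q ^ u) ^ n ≤ 2 ^ (lq * u * n) := by
    calc (q ^ u) ^ n = q ^ (u * n) := (pow_mul q u n).symm
      _ ≤ (2 ^ lq) ^ (u * n) := Nat.pow_le_pow_left hqlq _
      _ = 2 ^ (lq * u * n) := by rw [← pow_mul, mul_assoc]
  have h3d : 3 * d + 1 ≤ 2 ^ (E + 2) := by
    rw [pow_add]; norm_num
    have := Nat.one_le_two_pow (n := E)
    omega
  have harg : (q ^ u) ^ n * (3 * d + 1) + 1 ≤ 2 ^ (lq * u * n + E + 3) := by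
    have := succ_le_two_pow (mul_le_two_pow hqun h3d)
    calc _ ≤ 2 ^ (lq * u * n + (E + 2) + 1) := this
      _ = 2 ^ (lq * u * n + E + 3) := by ring_nf
  have hT : Nat.log 2 ((q ^ u) ^ n * (3 * d + 1) + 1) + 1 ≤ lq * u * n + (E + 4) := by
    have : Nat.log 2 ((q ^ u) ^ n * (3 * d + 1) + 1) < lq * u * n + E + 4 := by
      rw [Nat.log_lt_iff_lt_pow (by norm_num) (by omega)]
      exact lt_of_le_of_lt harg (Nat.pow_lt_pow_right (by norm_num) (by omega))
    omega
  have hT2 : Nat.log 2 ((q ^ u) ^ n * (3 * d + 1) + 1) + 1 ≤ 2 ^ (lq + 2 * E + 4) := by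
    have hlq2 : lq ≤ 2 ^ lq := (@Nat.lt_two_pow_self lq).le
    have h1 : lq * u * n ≤ 2 ^ (lq + (E + 3) + E) := by
      calc lq * u * n ≤ 2 ^ lq * 2 ^ (E + 3) * 2 ^ E :=
            Nat.mul_le_mul (Nat.mul_le_mul hlq2 hu_pow) hnE
        _ = 2 ^ (lq + (E + 3) + E) := by rw [← pow_add, ← pow_add]
    have h2 : E + 4 ≤ 2 ^ (lq + (E + 3) + E) := by
      calc E + 4 ≤ 2 ^ (E + 3) := by have := add_five_le_two_pow E; omega
        _ ≤ 2 ^ (lq + (E + 3) + E) := two_pow_mono (by omega)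
    calc _ ≤ lq * u * n + (E + 4) := hT
      _ ≤ 2 ^ (lq + (E + 3) + E + 1) := add_le_two_pow h1 h2
      _ = 2 ^ (lq + 2 * E + 4) := by ring_nf
  -- the parameter count
  have hparams : 9376 * (n + d + n ^ L + 2) ^ 26 ≤ 2 ^ (26 * E + 66) := by
    have hX : n + d + n ^ L + 2 ≤ 2 ^ (E + 2) := by rw [pow_add]; norm_num; omega
    have h1 := pow_le_two_pow hX 26
    have h3 : (9376 : ℕ) ≤ 2 ^ 14 := by norm_num
    calc 9376 * (n + d + n ^ L + 2) ^ 26 ≤ 2 ^ 14 * 2 ^ ((E + 2) * 26) := Nat.mul_le_mul h3 h1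
      _ = 2 ^ (26 * E + 66) := by rw [← pow_add]; ring_nf
  -- the hitting-set size and `u · B`
  have hB : 9376 * (n + d + n ^ L + 2) ^ 26 *
      (Nat.log 2 ((q ^ u) ^ n * (3 * d + 1) + 1) + 1) + 1 ≤ 2 ^ (28 * E + lq + 71) := by
    calc _ ≤ 2 ^ (26 * E + 66 + (lq + 2 * E + 4) + 1) := succ_le_two_pow (mul_le_two_pow hparams hT2)
      _ = 2 ^ (28 * E + lq + 71) := by ring_nf
  have huB : u * (9376 * (n + d + n ^ L + 2) ^ 26 *
      (Nat.log 2 ((q ^ u) ^ n * (3 * d + 1) + 1) + 1) + 1) ≤ 2 ^ (29 * E + lq + 74) := by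
    calc _ ≤ 2 ^ (E + 3 + (28 * E + lq + 71)) := mul_le_two_pow hu_pow hB
      _ = 2 ^ (29 * E + lq + 74) := by ring_nf
  -- `N ≥ 2^n > 2^(29 E + lq + 74)`
  have hN : 2 ^ n ≤ (n + d).choose n := by
    have hnd : n ≤ d := by
      calc n = n ^ 1 := (pow_one n).symm
        _ ≤ n ^ c := Nat.pow_le_pow_right hn1 hc
    calc 2 ^ n ≤ (2 * n).choose n := two_pow_le_centralBinom n
      _ ≤ (n + d).choose n := Nat.choose_le_choose n (by omega)
  have hexp : 29 * E + lq + 74 < n := by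
    have h1 : 29 * E + lq + 74 = 29 * (c + 1) * (L + 1) ^ 2 + (lq + 74) := by rw [hEdef]; ring
    rw [h1]
    exact lt_of_lt_of_le hkey hpowL
  refine ⟨lt_of_le_of_lt huB (lt_of_lt_of_le (Nat.pow_lt_pow_right (by norm_num) hexp) hN), ?_⟩
  calc 8 * q ≤ 8 * 2 ^ lq := Nat.mul_le_mul_left _ hqlq
    _ = 2 ^ (lq + 3) := by rw [pow_add]; ring
    _ ≤ 2 ^ n := two_pow_mono (by omega)
    _ ≤ (n + d).choose n := hN

end Threshold

/-! ### The hitting set over an extension field -/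

/-- **Hitting set for `𝒞(n,d,s)` over `F` inside `Kⁿ`** for a finite extension `K ⊇ F` with
`|K| ≥ 2d + 1`: the tree's `HittingSets.exists_hittingSet` over `K`, applied to the base change
(`map_mem_vpSlice`). In print: "[HS80] … over a large enough extension of `𝔽`" (v4 Lemma 3.8 /
Thm. 4.1). [cite: ChatterjeeKumarRamyaSaptharishiTengse2020, Thm. 4.1 (arXiv v4), proof] -/
theorem exists_hittingSet_ext (F K : Type*) [Field F] [Field K] [Fintype K] [Algebra F K]
    (n s d : ℕ) (hK : 2 * d + 1 ≤ Fintype.card K) :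
    ∃ H : Finset (Fin n → K),
      H.card ≤ 9376 * (n + d + s + 2) ^ 26 *
          (Nat.log 2 (Fintype.card K ^ n * (3 * d + 1) + 1) + 1) + 1 ∧
      ∀ f ∈ vpSlice F n d s, f ≠ 0 → ∃ a ∈ H, eval a (MvPolynomial.map (algebraMap F K) f) ≠ 0 := by
  classical
  obtain ⟨H, -, hcard, hhit⟩ :=
    HittingSets.exists_hittingSet (F := K) n s d Finset.univ (by rwa [Finset.card_univ])
  refine ⟨H, by rwa [Finset.card_univ] at hcard, fun f hf hf0 => ?_⟩
  have hfK := map_mem_vpSlice (K := K) hf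
  refine hhit _ hfK.1 hfK.2 fun h0 => hf0 ?_
  exact map_injective _ (algebraMap F K).injective (by rw [h0, map_zero])

end FiniteFields

end CKRST2020

/-! ### The discharge -/

open CKRST2020.FiniteFields in
/-- **Discharge of `CKRST2020_thm_1_2`** (CKRST 2020 Thm. 1.7, "Thm 1.2": natural proofs for `VP`
over any finite field). For every `c ≥ 1` ONE family `P_n` over `𝔽` in the `N = binom(n+n^c, n)`
coefficient variables, of size and degree `≤ N^4` eventually, vanishing eventually on the
coefficient vectors of every `n`-variate, degree-`n^c`, size-`n^k` polynomial over `𝔽` (every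
`k`), and nonzero at some coefficient vector of degree `≤ n^c`: the printed construction
`OR(z) · ∏_{a ∈ ℋ} ∏_i (1 - L_{a,i}^{|𝔽|-1})` over the degree-`u` extension for the size schedule
`n^{⌊log₂ n⌋}` (`exists_equation`, `exists_hittingSet_ext`, `threshold`).
[cite: ChatterjeeKumarRamyaSaptharishiTengse2020, Thm. 1.7 (MainThmFiniteFields) with Thm. 4.1 (arXiv v4)] -/
theorem CKRST2020_thm_1_2_holds : ∀ (F : Type*) [Field F] [Fintype F], CKRST2020_thm_1_2 F := by
  intro F _ _ c hc
  classical
  haveI : Fact (ringChar F).Prime := ⟨CharP.char_is_prime F (ringChar F)⟩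
  set q := Fintype.card F with hq
  have hq1 : 1 < q := Fintype.one_lt_card
  have hq2 : 2 ≤ q := hq1
  -- the size of the hitting set over the degree-`u` extension, as a function of `n`
  set B : ℕ → ℕ := fun n => 9376 * (n + n ^ c + n ^ Nat.log 2 n + 2) ^ 26 *
      (Nat.log 2 ((q ^ (Nat.log q (2 * n ^ c + 1) + 1)) ^ n * (3 * n ^ c + 1) + 1) + 1) + 1 with hB
  -- the per-`n` construction
  have key : ∀ n : ℕ, ∃ P : MvPolynomial (monomialsDegLE n (n ^ c)) F,
      (complexity P ≤ 8 * q * Nat.card (monomialsDegLE n (n ^ c)) *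
          ((Nat.log q (2 * n ^ c + 1) + 1) * B n + 1) ∧
        P.totalDegree ≤ q * (Nat.card (monomialsDegLE n (n ^ c)) +
          (Nat.log q (2 * n ^ c + 1) + 1) * B n)) ∧
      (∀ f ∈ vpSlice F n (n ^ c) (n ^ Nat.log 2 n),
        eval (coeffVector (monomialsDegLE n (n ^ c)) f) P = 0) ∧
      ((Nat.log q (2 * n ^ c + 1) + 1) * B n < Nat.card (monomialsDegLE n (n ^ c)) →
        ∃ h : MvPolynomial (Fin n) F, h.totalDegree ≤ n ^ c ∧
          eval (coeffVector (monomialsDegLE n (n ^ c)) h) P ≠ 0) := by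
    intro n
    haveI : Fintype (monomialsDegLE n (n ^ c)) :=
      (Finsupp.finite_of_degree_le (σ := Fin n) (n ^ c)).fintype
    haveI : Fintype (FiniteField.Extension F (ringChar F) (Nat.log q (2 * n ^ c + 1) + 1)) :=
      Fintype.ofFinite _
    have hKcard : Fintype.card (FiniteField.Extension F (ringChar F) (Nat.log q (2 * n ^ c + 1) + 1)) =
        q ^ (Nat.log q (2 * n ^ c + 1) + 1) := by
      rw [Fintype.card_eq_nat_card, FiniteField.natCard_extension, Nat.card_eq_fintype_card]
    have hKu : Module.finrank F (FiniteField.Extension F (ringChar F) (Nat.log q (2 * n ^ c + 1) + 1)) =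
        Nat.log q (2 * n ^ c + 1) + 1 :=
      FiniteField.finrank_extension F (ringChar F) _
    have h2d : 2 * n ^ c + 1 ≤
        Fintype.card (FiniteField.Extension F (ringChar F) (Nat.log q (2 * n ^ c + 1) + 1)) := by
      rw [hKcard]; exact (Nat.lt_pow_succ_log_self hq1 _).le
    obtain ⟨H, hHcard, hHhit⟩ := exists_hittingSet_ext F
      (FiniteField.Extension F (ringChar F) (Nat.log q (2 * n ^ c + 1) + 1)) n (n ^ Nat.log 2 n) (n ^ c) h2d
    rw [hKcard] at hHcard
    have hHB : H.card ≤ B n := hHcard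
    obtain ⟨P, hPc, hPd, hPvan, hPwit⟩ := exists_equation (F := F)
      (K := FiniteField.Extension F (ringChar F) (Nat.log q (2 * n ^ c + 1) + 1)) (n := n) (d := n ^ c) H
    rw [hKu] at hPc hPd hPwit
    have hNcard : Fintype.card (monomialsDegLE n (n ^ c)) = Nat.card (monomialsDegLE n (n ^ c)) :=
      Nat.card_eq_fintype_card.symm
    rw [hNcard] at hPc hPd hPwit
    have hUB : (Nat.log q (2 * n ^ c + 1) + 1) * H.card ≤ (Nat.log q (2 * n ^ c + 1) + 1) * B n :=
      Nat.mul_le_mul_left _ hHB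
    refine ⟨P, ⟨hPc.trans (by gcongr), hPd.trans (by gcongr)⟩, ?_, fun hlt => hPwit (lt_of_le_of_lt hUB hlt)⟩
    intro f hf
    exact hPvan f hf.1 fun hf0 => hHhit f hf hf0
  -- `N = binom(n + n^c, n)`
  have hN : ∀ n, Nat.card (monomialsDegLE n (n ^ c)) = (n + n ^ c).choose n := fun n =>
    (GKSS2017.ncard_degLE n (n ^ c)).trans Nat.choose_symm_add.symm
  choose P hP using key
  obtain ⟨n₀, hn₀⟩ := threshold q c hq2 hc
  refine ⟨4, P, ⟨n₀, fun n hn => ?_⟩, fun k => ⟨2 ^ k, fun n hn f hf => ?_⟩, ⟨n₀, fun n hn => ?_⟩⟩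
  · -- constructivity: size and degree `≤ N^4`
    obtain ⟨hlt, h8q⟩ := hn₀ n hn
    obtain ⟨⟨hc1, hd1⟩, -, -⟩ := hP n
    rw [hN n] at hc1 hd1
    set N := (n + n ^ c).choose n with hNdef
    have hUB1 : (Nat.log q (2 * n ^ c + 1) + 1) * B n + 1 ≤ N := hlt
    have hN1 : 1 ≤ N := le_trans (by omega) h8q
    constructor
    · calc complexity (P n) ≤ 8 * q * N * ((Nat.log q (2 * n ^ c + 1) + 1) * B n + 1) := hc1
        _ ≤ 8 * q * N * N := Nat.mul_le_mul_left _ hUB1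
        _ ≤ N * N * N * N := by
            have : 8 * q * N ≤ N * N * N := by
              calc 8 * q * N ≤ N * N := Nat.mul_le_mul_right _ h8q
                _ ≤ N * N * N := Nat.le_mul_of_pos_right _ (by omega)
            exact Nat.mul_le_mul_right _ this
        _ = N ^ 4 := by ring
    · calc (P n).totalDegree ≤ q * (N + (Nat.log q (2 * n ^ c + 1) + 1) * B n) := hd1
        _ ≤ q * (N + N) := Nat.mul_le_mul_left _ (Nat.add_le_add_left (le_of_lt hlt) _)
        _ = 2 * q * N := by ring
        _ ≤ N * N := Nat.mul_le_mul_right _ (by omega)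
        _ ≤ N ^ 4 := by
            calc N * N = N ^ 2 := (pow_two N).symm
              _ ≤ N ^ 4 := Nat.pow_le_pow_right hN1 (by norm_num)
  · -- vanishing: for `n ≥ 2^k`, `n^k ≤ n^{⌊log₂ n⌋}`
    obtain ⟨-, hvan, -⟩ := hP n
    have hn1 : 0 < n := lt_of_lt_of_le (Nat.two_pow_pos k) hn
    have hk : k ≤ Nat.log 2 n := Nat.le_log_of_pow_le (by norm_num) hn
    exact hvan f ⟨hf.1, hf.2.trans (Nat.pow_le_pow_right hn1 hk)⟩
  · -- the non-vanishing witness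
    obtain ⟨hlt, -⟩ := hn₀ n hn
    obtain ⟨-, -, hwit⟩ := hP n
    rw [hN n] at hwit
    exact hwit hlt


/-! ## Thm. 1.9 ("Thm 1.4"): the `VNP` slice over a finite field -/

namespace CKRST2020

namespace FiniteFields

/-! ### Base change of Boolean sums and of the `VNP` slice -/

section VNPBaseChange

variable {k k' : Type*} [CommSemiring k] [CommSemiring k'] {τ : Type*} {m : ℕ}

/-- Extension of scalars commutes with Valiant's Boolean sum. [folklore] -/
private theorem map_boolSum (φ : k →+* k') (g : MvPolynomial (τ ⊕ Fin m) k) :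
    MvPolynomial.map φ (boolSum g) = boolSum (MvPolynomial.map φ g) := by
  unfold boolSum
  rw [map_sum]
  refine Finset.sum_congr rfl fun e _ => ?_
  rw [aeval_eq_bind₁, aeval_eq_bind₁, map_bind₁]
  have hfun : (fun i => MvPolynomial.map φ (Sum.elim X (fun j => if e j then (1 : MvPolynomial τ k) else 0) i)) =
      Sum.elim X (fun j => if e j then (1 : MvPolynomial τ k') else 0) := by
    funext i
    rcases i with i | j
    · simp
    · simp only [Sum.elim_inr]
      split_ifs <;> simp
  rw [hfun]

end VNPBaseChange

/-- **Base change of the `VNP` slice.** A degree-`≤ d` exponential sum of a size-and-degree-`≤ t`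
polynomial over `F` is one over any extension field `K`.
[cite: ChatterjeeKumarRamyaSaptharishiTengse2020, Thm. 4.2 (arXiv v4), proof (v2 ‹Def 8›)] -/
theorem map_mem_vnpSlice {F K : Type*} [Field F] [Field K] [Algebra F K] {n d t : ℕ}
    {f : MvPolynomial (Fin n) F} (hf : f ∈ vnpSlice F n d t) :
    MvPolynomial.map (algebraMap F K) f ∈ vnpSlice K n d t := by
  obtain ⟨hfd, m, hm, g, hgc, hgd, hfg⟩ := hf
  refine ⟨(totalDegree_map_le _ f).trans hfd, m, hm, MvPolynomial.map (algebraMap F K) g,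
    (ArithCircuit.complexity_map_le _ g).trans hgc, (totalDegree_map_le _ g).trans hgd, ?_⟩
  rw [hfg, map_boolSum]

/-! ### A hitting set for a small finite class over a finite field -/

section FiniteClass

variable {K : Type*} [Field K] [Fintype K]

open Finset Fintype in
/-- **Non-explicit hitting sets for a finite class (v2 ‹Lemma 10›/‹Claim 18› style, over the whole
field).** If `𝒜` is a finite set of nonzero `n`-variate polynomials of degree `≤ d` over a finite
field `K` with `|K| ≥ 2d`, and `|𝒜| < 2^h`, then some `h` points of `Kⁿ` hit every member of `𝒜`:
a member vanishes on at most a `d/|K| ≤ 1/2` fraction of `Kⁿ` (Schwartz–Zippel, Mathlib), so fewer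
than all `h`-tuples of points are bad for some member.
[cite: ChatterjeeKumarRamyaSaptharishiTengse2020, Lemma 3.9 / Claim 3.11 (arXiv v4), proof] -/
theorem exists_hittingSet_of_finset {n d h : ℕ} (𝒜 : Finset (MvPolynomial (Fin n) K))
    (h𝒜 : ∀ f ∈ 𝒜, f ≠ 0 ∧ f.totalDegree ≤ d) (hK : 2 * d ≤ Fintype.card K)
    (hcard : 𝒜.card < 2 ^ h) :
    ∃ H : Finset (Fin n → K), H.card ≤ h ∧ ∀ f ∈ 𝒜, ∃ a ∈ H, eval a f ≠ 0 := by
  classical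
  rcases Nat.eq_zero_or_pos n with hn | hn
  · -- no variables: nonzero constants are hit by the (unique) point
    subst hn
    rcases 𝒜.eq_empty_or_nonempty with h0 | hne
    · exact ⟨∅, by simp, by simp [h0]⟩
    · have hh : 1 ≤ h := by
        rcases Nat.eq_zero_or_pos h with h0 | h0
        · subst h0; have := hne.card_pos; omega
        · exact h0
      refine ⟨{Fin.elim0}, by simpa using hh, fun f hf => ⟨Fin.elim0, mem_singleton_self _, ?_⟩⟩
      rw [eq_C_of_isEmpty f, eval_C]
      intro hc
      exact (h𝒜 f hf).1 (by rw [eq_C_of_isEmpty f, hc, C_0])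
  · -- `n = k + 1`
    obtain ⟨k, rfl⟩ : ∃ k, n = k + 1 := ⟨n - 1, by omega⟩
    set L := Fintype.card K with hL
    have hL1 : 1 ≤ L := Fintype.card_pos
    set T : Finset (Fin h → Fin (k + 1) → K) := Finset.univ with hT
    set Z : MvPolynomial (Fin (k + 1)) K → Finset (Fin (k + 1) → K) :=
      fun f => {y ∈ (Finset.univ : Finset (Fin (k + 1) → K)) | eval y f = 0} with hZ
    set Bad : Finset (Fin h → Fin (k + 1) → K) := 𝒜.biUnion fun f => piFinset fun _ : Fin h => Z f
      with hBad
    -- Schwartz–Zippel over the whole space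
    have hZle : ∀ f ∈ 𝒜, (Z f).card ≤ d * L ^ k := by
      intro f hf
      obtain ⟨hf0, hfd⟩ := h𝒜 f hf
      have hSZ := MvPolynomial.schwartz_zippel_totalDegree hf0 (Finset.univ : Finset K)
      rw [Finset.card_univ, ← hL, Fintype.piFinset_univ] at hSZ
      have hL0 : (0 : ℚ≥0) < L := by exact_mod_cast hL1
      rw [div_le_div_iff₀ (pow_pos hL0 _) hL0] at hSZ
      have hZ' : (Z f).card * L ≤ f.totalDegree * L ^ (k + 1) := by exact_mod_cast hSZ
      rw [pow_succ, ← mul_assoc] at hZ'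
      exact (Nat.le_of_mul_le_mul_right hZ' (by omega)).trans (Nat.mul_le_mul_right _ hfd)
    have hBadcard : Bad.card < T.card := by
      have hT' : T.card = (L ^ (k + 1)) ^ h := by
        rw [hT, Finset.card_univ, Fintype.card_fun, Fintype.card_fin, Fintype.card_fun,
          Fintype.card_fin, hL]
      calc Bad.card ≤ ∑ f ∈ 𝒜, (piFinset fun _ : Fin h => Z f).card := Finset.card_biUnion_le
        _ ≤ ∑ _f ∈ 𝒜, (d * L ^ k) ^ h := Finset.sum_le_sum fun f hf => by
            rw [card_piFinset_const]; exact Nat.pow_le_pow_left (hZle f hf) _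
        _ = 𝒜.card * (d * L ^ k) ^ h := by rw [Finset.sum_const, smul_eq_mul]
        _ < (L ^ (k + 1)) ^ h := by
            rcases Nat.eq_zero_or_pos ((d * L ^ k) ^ h) with h0 | hpos
            · rw [h0, mul_zero]; positivity
            · calc 𝒜.card * (d * L ^ k) ^ h < 2 ^ h * (d * L ^ k) ^ h :=
                    Nat.mul_lt_mul_of_pos_right hcard hpos
                _ = (2 * d * L ^ k) ^ h := by rw [← mul_pow]; ring
                _ ≤ (L * L ^ k) ^ h :=
                    Nat.pow_le_pow_left (Nat.mul_le_mul_right _ hK) _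
                _ = (L ^ (k + 1)) ^ h := by rw [pow_succ']
        _ = T.card := hT'.symm
    obtain ⟨tup, -, htBad⟩ := Finset.exists_mem_notMem_of_card_lt_card hBadcard
    refine ⟨Finset.univ.image tup, Finset.card_image_le.trans (by simp), fun f hf => ?_⟩
    have ht : tup ∉ piFinset fun _ : Fin h => Z f := fun ht =>
      htBad (by rw [hBad, Finset.mem_biUnion]; exact ⟨f, hf, ht⟩)
    rw [mem_piFinset, not_forall] at ht
    obtain ⟨j, hj⟩ := ht
    have hne : eval (tup j) f ≠ 0 := fun h0 =>
      hj (by rw [hZ]; exact Finset.mem_filter.2 ⟨Finset.mem_univ _, h0⟩)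
    exact ⟨tup j, Finset.mem_image.2 ⟨j, Finset.mem_univ _, rfl⟩, hne⟩

end FiniteClass

/-! ### Counting the `VNP` slice over a finite field, and its hitting set -/

section VNPCount

variable (K : Type*) [Field K] [Fintype K]

/-- **The `VNP` slice over a finite field is small** (v4 Claim 3.11-type count, here DIRECTLY for
exponential sums rather than via `s`-definability): every member of `vnpSlice K n d t` is
`boolSum g` for a `g` in `n + m ≤ n + t` variables of complexity `≤ t`, so by the circuit count
(`CircuitCount.exists_finset_complexity_le`, [F14, L. 3.1.6] = v4 Claim 3.10) the slice lies in a
finite set of at most `(t+1) · (2 q² (n + 2t + q)²)^t (n + 2t + q)` polynomials, `q = |K|`.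
[cite: ChatterjeeKumarRamyaSaptharishiTengse2020, Claims 3.10–3.11 (arXiv v4), proof] -/
theorem exists_finset_vnpSlice (n d t : ℕ) :
    ∃ 𝒜 : Finset (MvPolynomial (Fin n) K),
      𝒜.card ≤ (t + 1) * ((2 * Fintype.card K ^ 2 * (n + t + Fintype.card K + t) ^ 2) ^ t *
          (n + t + Fintype.card K + t)) ∧
      ∀ f ∈ vnpSlice K n d t, f ∈ 𝒜 := by
  classical
  set q := Fintype.card K with hq
  have hC : ∀ m : Fin (t + 1), ∃ 𝒞 : Finset (MvPolynomial (Fin n ⊕ Fin m) K),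
      𝒞.card ≤ (2 * q ^ 2 * (n + m + q + t) ^ 2) ^ t * (n + m + q + t) ∧
        ∀ g : MvPolynomial (Fin n ⊕ Fin m) K, complexity g ≤ t → g ∈ 𝒞 := by
    intro m
    obtain ⟨𝒞, hcard, hmem⟩ := CircuitCount.exists_finset_complexity_le K (Fin n ⊕ Fin m) t
    refine ⟨𝒞, ?_, hmem⟩
    simpa only [Fintype.card_sum, Fintype.card_fin, hq] using hcard
  choose 𝒞 h𝒞card h𝒞mem using hC
  refine ⟨Finset.univ.biUnion fun m : Fin (t + 1) => (𝒞 m).image boolSum, ?_, ?_⟩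
  · calc (Finset.univ.biUnion fun m : Fin (t + 1) => (𝒞 m).image boolSum).card
        ≤ ∑ m : Fin (t + 1), ((𝒞 m).image boolSum).card := Finset.card_biUnion_le
      _ ≤ ∑ m : Fin (t + 1), (2 * q ^ 2 * (n + t + q + t) ^ 2) ^ t * (n + t + q + t) := by
          refine Finset.sum_le_sum fun m _ => Finset.card_image_le.trans ((h𝒞card m).trans ?_)
          have hm : (m : ℕ) ≤ t := Nat.le_of_lt_succ m.2
          gcongr
      _ = (t + 1) * ((2 * q ^ 2 * (n + t + q + t) ^ 2) ^ t * (n + t + q + t)) := by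
          rw [Finset.sum_const, smul_eq_mul, Finset.card_univ, Fintype.card_fin]
  · intro f hf
    obtain ⟨-, m, hm, g, hgc, -, hfg⟩ := hf
    rw [Finset.mem_biUnion]
    exact ⟨⟨m, Nat.lt_succ_of_le hm⟩, Finset.mem_univ _,
      Finset.mem_image.mpr ⟨g, h𝒞mem ⟨m, Nat.lt_succ_of_le hm⟩ g hgc, hfg.symm⟩⟩

/-- The count in powers of two: `(t+1) · (2 q² M²)^t · M < 2^{(t+1)(2 ℓ_q + 2 ℓ_M + 2)}` with
`ℓ_x = ⌊log₂ x⌋ + 1`, `M = n + 2t + q`. [folklore] -/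
private theorem count_lt_two_pow (q n t : ℕ) :
    (t + 1) * ((2 * q ^ 2 * (n + t + q + t) ^ 2) ^ t * (n + t + q + t)) <
      2 ^ ((t + 1) * (2 * (Nat.log 2 q + 1) + 2 * (Nat.log 2 (n + t + q + t) + 1) + 2)) := by
  set lq := Nat.log 2 q + 1 with hlq
  set M := n + t + q + t with hM
  set lM := Nat.log 2 M + 1 with hlM
  have hqlq : q ≤ 2 ^ lq := (Nat.lt_pow_succ_log_self (by norm_num) q).le
  have hMlM : M ≤ 2 ^ lM := (Nat.lt_pow_succ_log_self (by norm_num) M).le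
  have ht1 : t + 1 ≤ 2 ^ t := Nat.lt_two_pow_self
  have hbase : 2 * q ^ 2 * M ^ 2 ≤ 2 ^ (2 * lq + 2 * lM + 1) := by
    calc 2 * q ^ 2 * M ^ 2 ≤ 2 * (2 ^ lq) ^ 2 * (2 ^ lM) ^ 2 := by gcongr
      _ = 2 ^ (2 * lq + 2 * lM + 1) := by rw [← pow_mul, ← pow_mul]; ring
  calc (t + 1) * ((2 * q ^ 2 * M ^ 2) ^ t * M)
      ≤ 2 ^ t * ((2 ^ (2 * lq + 2 * lM + 1)) ^ t * 2 ^ lM) := by gcongr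
    _ = 2 ^ (t * (2 * lq + 2 * lM + 2) + lM) := by
        rw [← pow_mul, ← pow_add, ← pow_add]; ring_nf
    _ < 2 ^ ((t + 1) * (2 * lq + 2 * lM + 2)) :=
        Nat.pow_lt_pow_right (by norm_num) (by nlinarith)

/-- **Hitting set for the `VNP` slice over `F` inside `Kⁿ`**, `K ⊇ F` a finite field with
`|K| ≥ 2d` (`q = |K|`): `|ℋ| ≤ (t+1)(2⌊log₂ q⌋ + 2⌊log₂(n+2t+q)⌋ + 6)` points hitting every
nonzero member of `vnpSlice F n d t` read over `K` (count + Schwartz–Zippel, as v4 Lemma 3.9 /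
Thm. 4.2 use it "over a large enough extension").
[cite: ChatterjeeKumarRamyaSaptharishiTengse2020, Lemma 3.9 and Thm. 4.2 (arXiv v4), proof] -/
theorem exists_hittingSet_vnp_ext (F : Type*) [Field F] [Algebra F K] (n d t : ℕ)
    (hK : 2 * d ≤ Fintype.card K) :
    ∃ H : Finset (Fin n → K),
      H.card ≤ (t + 1) * (2 * (Nat.log 2 (Fintype.card K) + 1) +
          2 * (Nat.log 2 (n + t + Fintype.card K + t) + 1) + 2) ∧
      ∀ f ∈ vnpSlice F n d t, f ≠ 0 → ∃ a ∈ H, eval a (MvPolynomial.map (algebraMap F K) f) ≠ 0 := by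
  classical
  obtain ⟨𝒜₀, hcard₀, hmem₀⟩ := exists_finset_vnpSlice K n d t
  set 𝒜 := 𝒜₀.filter fun f => f ≠ 0 ∧ f.totalDegree ≤ d with h𝒜
  have h𝒜ok : ∀ f ∈ 𝒜, f ≠ 0 ∧ f.totalDegree ≤ d := fun f hf => (Finset.mem_filter.1 hf).2
  have hlt : 𝒜.card < 2 ^ ((t + 1) * (2 * (Nat.log 2 (Fintype.card K) + 1) +
      2 * (Nat.log 2 (n + t + Fintype.card K + t) + 1) + 2)) :=
    lt_of_le_of_lt ((Finset.card_filter_le _ _).trans hcard₀) (count_lt_two_pow _ n t)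
  obtain ⟨H, hH, hhit⟩ := exists_hittingSet_of_finset 𝒜 h𝒜ok hK hlt
  refine ⟨H, hH, fun f hf hf0 => hhit _ ?_⟩
  have hfK := map_mem_vnpSlice (K := K) hf
  refine Finset.mem_filter.2 ⟨hmem₀ _ hfK, fun h0 => hf0 ?_, hfK.1⟩
  exact map_injective _ (algebraMap F K).injective (by rw [h0, map_zero])

end VNPCount

/-! ### Arithmetic for the `VNP` slice: `u · |ℋ| < N` -/

section ThresholdVNP

set_option maxHeartbeats 400000 in
/-- **The threshold for Thm. 1.9.** For `q ≥ 2`, `c ≥ 1`, `n ≥ n₀(q,c)`: with `d = n^c`,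
`t = n^{⌊log₂ n⌋}`, `u = ⌊log_q(2d+1)⌋ + 1`, `Q = q^u` and
`h = (t+1)(2(⌊log₂ Q⌋+1) + 2(⌊log₂(n+2t+Q)⌋+1) + 2)`: `u · h < N = binom(n+d, n)` and `8q ≤ N`.
[cite: ChatterjeeKumarRamyaSaptharishiTengse2020, §4 ("s = n^{log n}"), Thm. 4.2 (arXiv v4)] -/
theorem threshold_vnp (q c : ℕ) (hq : 2 ≤ q) (hc : 1 ≤ c) : ∃ n₀ : ℕ, ∀ n, n₀ ≤ n →
    (Nat.log q (2 * n ^ c + 1) + 1) *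
        ((n ^ Nat.log 2 n + 1) * (2 * (Nat.log 2 (q ^ (Nat.log q (2 * n ^ c + 1) + 1)) + 1) +
          2 * (Nat.log 2 (n + n ^ Nat.log 2 n + q ^ (Nat.log q (2 * n ^ c + 1) + 1) +
            n ^ Nat.log 2 n) + 1) + 2)) < (n + n ^ c).choose n ∧
    8 * q ≤ (n + n ^ c).choose n := by
  set lq := Nat.log 2 q + 1 with hlq
  have hqlq : q ≤ 2 ^ lq := (Nat.lt_pow_succ_log_self (by norm_num) q).le
  obtain ⟨L₀, hL₀⟩ := eventually_quad_lt_two_pow (5 * (c + 1)) (2 * lq + 20)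
  refine ⟨2 ^ max L₀ 1, fun n hn => ?_⟩
  set L := Nat.log 2 n with hLdef
  set E := (c + 1) * (L + 1) ^ 2 with hEdef
  have hn1 : 1 ≤ n := le_trans Nat.one_le_two_pow hn
  have hL0 : L₀ ≤ L := by
    rw [hLdef]
    exact le_trans (le_max_left _ _) (Nat.le_log_of_pow_le (by norm_num) hn)
  have hkey : 5 * (c + 1) * (L + 1) ^ 2 + (2 * lq + 20) < 2 ^ L := hL₀ L hL0
  have hpowL : 2 ^ L ≤ n := by rw [hLdef]; exact Nat.pow_log_le_self 2 (by omega)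
  have hE1 : 1 ≤ E := by rw [hEdef]; nlinarith
  obtain ⟨hnE, hdE, hsE⟩ := basic_le c n
  rw [← hLdef, ← hEdef] at hnE hdE hsE
  set d := n ^ c with hd
  set t := n ^ L with ht
  set u := Nat.log q (2 * d + 1) + 1 with hu
  -- `u ≤ E + 4`
  have hu_le : u ≤ E + 4 := by
    have h1 : Nat.log q (2 * d + 1) ≤ Nat.log 2 (2 * d + 1) := Nat.log_anti_left (by norm_num) hq
    have h2 : Nat.log 2 (2 * d + 1) < E + 3 := by
      rw [Nat.log_lt_iff_lt_pow (by norm_num) (by omega)]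
      calc 2 * d + 1 ≤ 2 * 2 ^ E + 2 ^ E := by have := Nat.one_le_two_pow (n := E); omega
        _ < 2 ^ (E + 3) := by rw [pow_add]; norm_num; omega
    omega
  -- `Q = q^u ≤ 2^(lq (E+4))`
  have hQ : q ^ u ≤ 2 ^ (lq * (E + 4)) := by
    calc q ^ u ≤ (2 ^ lq) ^ u := Nat.pow_le_pow_left hqlq _
      _ = 2 ^ (lq * u) := by rw [← pow_mul]
      _ ≤ 2 ^ (lq * (E + 4)) := two_pow_mono (Nat.mul_le_mul_left _ hu_le)
  -- the two logarithms
  have hlQ : Nat.log 2 (q ^ u) + 1 ≤ lq * (E + 4) + 1 := by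
    have : Nat.log 2 (q ^ u) ≤ lq * (E + 4) := by
      have h := Nat.log_mono_right (b := 2) hQ
      rwa [Nat.log_pow (by norm_num)] at h
    omega
  have hlM : Nat.log 2 (n + t + q ^ u + t) + 1 ≤ lq * (E + 4) + E + 4 := by
    have harg : n + t + q ^ u + t < 2 ^ (lq * (E + 4) + E + 3) := by
      have h3 : n + t + t ≤ 3 * 2 ^ E := by omega
      calc n + t + q ^ u + t ≤ 3 * 2 ^ E + 2 ^ (lq * (E + 4)) := by omega
        _ < 2 ^ (E + 2) + 2 ^ (lq * (E + 4)) := by rw [pow_add]; norm_num; omega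
        _ ≤ 2 ^ (lq * (E + 4) + E + 2) + 2 ^ (lq * (E + 4) + E + 2) :=
            Nat.add_le_add (two_pow_mono (by omega)) (two_pow_mono (by omega))
        _ = 2 ^ (lq * (E + 4) + E + 3) := by rw [pow_succ]; ring
    have : Nat.log 2 (n + t + q ^ u + t) < lq * (E + 4) + E + 3 := by
      rcases Nat.eq_zero_or_pos (n + t + q ^ u + t) with h0 | hpos
      · rw [h0, Nat.log_zero_right]; omega
      · exact (Nat.log_lt_iff_lt_pow (by norm_num) (by omega)).2 harg
    omega
  -- `h ≤ 2^(E+1) · (4 lq (E+4) + 2E + 12)` and everything `< 2^n`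
  have hh : (t + 1) * (2 * (Nat.log 2 (q ^ u) + 1) + 2 * (Nat.log 2 (n + t + q ^ u + t) + 1) + 2) ≤
      2 ^ (E + 1) * (4 * (lq * (E + 4)) + 2 * E + 12) := by
    have ht1 : t + 1 ≤ 2 ^ (E + 1) := by rw [pow_succ]; omega
    refine Nat.mul_le_mul ht1 ?_
    omega
  have hlin : 4 * (lq * (E + 4)) + 2 * E + 12 ≤ 2 ^ (2 * lq + E + 7) := by
    -- crude: x ≤ 2^x style bounds
    have h1 : lq * (E + 4) ≤ 2 ^ (lq + E + 3) := by
      have := mul_le_two_pow (Nat.lt_two_pow_self (n := lq)).le (add_five_le_two_pow E)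
      exact le_trans (Nat.mul_le_mul_left _ (by omega)) this
    have h2 : 2 * E + 12 ≤ 2 ^ (E + 5) := by
      have := add_five_le_two_pow E; rw [show E + 5 = (E + 3) + 2 by ring, pow_add]; norm_num; omega
    calc 4 * (lq * (E + 4)) + 2 * E + 12 ≤ 4 * 2 ^ (lq + E + 3) + 2 ^ (E + 5) := by omega
      _ = 2 ^ (lq + E + 5) + 2 ^ (E + 5) := by rw [show lq + E + 5 = (lq + E + 3) + 2 by ring, pow_add _ (lq + E + 3) 2]; ring
      _ ≤ 2 ^ (2 * lq + E + 6) + 2 ^ (2 * lq + E + 6) :=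
          Nat.add_le_add (two_pow_mono (by omega)) (two_pow_mono (by omega))
      _ = 2 ^ (2 * lq + E + 7) := by rw [pow_succ]; ring
  have huh : u * ((t + 1) * (2 * (Nat.log 2 (q ^ u) + 1) +
      2 * (Nat.log 2 (n + t + q ^ u + t) + 1) + 2)) ≤ 2 ^ (E + 3 + (E + 1 + (2 * lq + E + 7))) := by
    have hu_pow : u ≤ 2 ^ (E + 3) := hu_le.trans (by have := add_five_le_two_pow E; omega)
    exact mul_le_two_pow hu_pow (hh.trans (mul_le_two_pow le_rfl hlin))
  have hN : 2 ^ n ≤ (n + d).choose n := by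
    have hnd : n ≤ d := by
      calc n = n ^ 1 := (pow_one n).symm
        _ ≤ n ^ c := Nat.pow_le_pow_right hn1 hc
    calc 2 ^ n ≤ (2 * n).choose n := two_pow_le_centralBinom n
      _ ≤ (n + d).choose n := Nat.choose_le_choose n (by omega)
  have hexp : E + 3 + (E + 1 + (2 * lq + E + 7)) < n := by
    have h1 : E + 3 + (E + 1 + (2 * lq + E + 7)) ≤ 5 * (c + 1) * (L + 1) ^ 2 + (2 * lq + 20) := by
      rw [hEdef]; nlinarith
    exact lt_of_le_of_lt h1 (lt_of_lt_of_le hkey hpowL)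
  refine ⟨lt_of_le_of_lt huh (lt_of_lt_of_le (Nat.pow_lt_pow_right (by norm_num) hexp) hN), ?_⟩
  calc 8 * q ≤ 8 * 2 ^ lq := Nat.mul_le_mul_left _ hqlq
    _ = 2 ^ (lq + 3) := by rw [pow_add]; ring
    _ ≤ 2 ^ n := two_pow_mono (by nlinarith)
    _ ≤ (n + d).choose n := hN

end ThresholdVNP

end FiniteFields

end CKRST2020

open CKRST2020.FiniteFields in
/-- **Discharge of `CKRST2020_thm_1_4`** (CKRST 2020 Thm. 1.9, "Thm 1.4": natural proofs for
`VNP` over any finite field). Same construction as `CKRST2020_thm_1_2_holds` with the hitting set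
of the `VNP` slice over the degree-`u` extension (`exists_hittingSet_vnp_ext`: direct count of the
exponential sums + Schwartz–Zippel), `e = 4`.
[cite: ChatterjeeKumarRamyaSaptharishiTengse2020, Thm. 1.9 (VNPfiniteField) with Thm. 4.2 (arXiv v4)] -/
theorem CKRST2020_thm_1_4_holds : ∀ (F : Type*) [Field F] [Fintype F], CKRST2020_thm_1_4 F := by
  intro F _ _ c hc
  classical
  haveI : Fact (ringChar F).Prime := ⟨CharP.char_is_prime F (ringChar F)⟩
  set q := Fintype.card F with hq
  have hq1 : 1 < q := Fintype.one_lt_card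
  have hq2 : 2 ≤ q := hq1
  -- the size of the hitting set over the degree-`u` extension, as a function of `n`
  set B : ℕ → ℕ := fun n => (n ^ Nat.log 2 n + 1) *
      (2 * (Nat.log 2 (q ^ (Nat.log q (2 * n ^ c + 1) + 1)) + 1) +
        2 * (Nat.log 2 (n + n ^ Nat.log 2 n + q ^ (Nat.log q (2 * n ^ c + 1) + 1) +
          n ^ Nat.log 2 n) + 1) + 2) with hB
  have key : ∀ n : ℕ, ∃ P : MvPolynomial (monomialsDegLE n (n ^ c)) F,
      (complexity P ≤ 8 * q * Nat.card (monomialsDegLE n (n ^ c)) *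
          ((Nat.log q (2 * n ^ c + 1) + 1) * B n + 1) ∧
        P.totalDegree ≤ q * (Nat.card (monomialsDegLE n (n ^ c)) +
          (Nat.log q (2 * n ^ c + 1) + 1) * B n)) ∧
      (∀ f ∈ vnpSlice F n (n ^ c) (n ^ Nat.log 2 n),
        eval (coeffVector (monomialsDegLE n (n ^ c)) f) P = 0) ∧
      ((Nat.log q (2 * n ^ c + 1) + 1) * B n < Nat.card (monomialsDegLE n (n ^ c)) →
        ∃ h : MvPolynomial (Fin n) F, h.totalDegree ≤ n ^ c ∧
          eval (coeffVector (monomialsDegLE n (n ^ c)) h) P ≠ 0) := by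
    intro n
    haveI : Fintype (monomialsDegLE n (n ^ c)) :=
      (Finsupp.finite_of_degree_le (σ := Fin n) (n ^ c)).fintype
    haveI : Fintype (FiniteField.Extension F (ringChar F) (Nat.log q (2 * n ^ c + 1) + 1)) :=
      Fintype.ofFinite _
    have hKcard : Fintype.card (FiniteField.Extension F (ringChar F) (Nat.log q (2 * n ^ c + 1) + 1)) =
        q ^ (Nat.log q (2 * n ^ c + 1) + 1) := by
      rw [Fintype.card_eq_nat_card, FiniteField.natCard_extension, Nat.card_eq_fintype_card]
    have hKu : Module.finrank F (FiniteField.Extension F (ringChar F) (Nat.log q (2 * n ^ c + 1) + 1)) =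
        Nat.log q (2 * n ^ c + 1) + 1 :=
      FiniteField.finrank_extension F (ringChar F) _
    have h2d : 2 * n ^ c ≤
        Fintype.card (FiniteField.Extension F (ringChar F) (Nat.log q (2 * n ^ c + 1) + 1)) := by
      rw [hKcard]; exact le_of_lt (Nat.lt_of_succ_le (Nat.lt_pow_succ_log_self hq1 _).le)
    obtain ⟨H, hHcard, hHhit⟩ := exists_hittingSet_vnp_ext
      (FiniteField.Extension F (ringChar F) (Nat.log q (2 * n ^ c + 1) + 1)) F n (n ^ c)
      (n ^ Nat.log 2 n) h2d
    rw [hKcard] at hHcard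
    have hHB : H.card ≤ B n := hHcard
    obtain ⟨P, hPc, hPd, hPvan, hPwit⟩ := exists_equation (F := F)
      (K := FiniteField.Extension F (ringChar F) (Nat.log q (2 * n ^ c + 1) + 1)) (n := n) (d := n ^ c) H
    rw [hKu] at hPc hPd hPwit
    have hNcard : Fintype.card (monomialsDegLE n (n ^ c)) = Nat.card (monomialsDegLE n (n ^ c)) :=
      Nat.card_eq_fintype_card.symm
    rw [hNcard] at hPc hPd hPwit
    have hUB : (Nat.log q (2 * n ^ c + 1) + 1) * H.card ≤ (Nat.log q (2 * n ^ c + 1) + 1) * B n :=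
      Nat.mul_le_mul_left _ hHB
    refine ⟨P, ⟨hPc.trans (by gcongr), hPd.trans (by gcongr)⟩, ?_, fun hlt => hPwit (lt_of_le_of_lt hUB hlt)⟩
    intro f hf
    exact hPvan f hf.1 fun hf0 => hHhit f hf hf0
  have hN : ∀ n, Nat.card (monomialsDegLE n (n ^ c)) = (n + n ^ c).choose n := fun n =>
    (GKSS2017.ncard_degLE n (n ^ c)).trans Nat.choose_symm_add.symm
  choose P hP using key
  obtain ⟨n₀, hn₀⟩ := threshold_vnp q c hq2 hc
  refine ⟨4, P, ⟨n₀, fun n hn => ?_⟩, fun k => ⟨2 ^ k, fun n hn f hf => ?_⟩, ⟨n₀, fun n hn => ?_⟩⟩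
  · obtain ⟨hlt, h8q⟩ := hn₀ n hn
    obtain ⟨⟨hc1, hd1⟩, -, -⟩ := hP n
    rw [hN n] at hc1 hd1
    set N := (n + n ^ c).choose n with hNdef
    have hUB1 : (Nat.log q (2 * n ^ c + 1) + 1) * B n + 1 ≤ N := hlt
    have hN1 : 1 ≤ N := le_trans (by omega) h8q
    constructor
    · calc complexity (P n) ≤ 8 * q * N * ((Nat.log q (2 * n ^ c + 1) + 1) * B n + 1) := hc1
        _ ≤ 8 * q * N * N := Nat.mul_le_mul_left _ hUB1
        _ ≤ N * N * N * N := by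
            have : 8 * q * N ≤ N * N * N := by
              calc 8 * q * N ≤ N * N := Nat.mul_le_mul_right _ h8q
                _ ≤ N * N * N := Nat.le_mul_of_pos_right _ (by omega)
            exact Nat.mul_le_mul_right _ this
        _ = N ^ 4 := by ring
    · calc (P n).totalDegree ≤ q * (N + (Nat.log q (2 * n ^ c + 1) + 1) * B n) := hd1
        _ ≤ q * (N + N) := Nat.mul_le_mul_left _ (Nat.add_le_add_left (le_of_lt hlt) _)
        _ = 2 * q * N := by ring
        _ ≤ N * N := Nat.mul_le_mul_right _ (by omega)
        _ ≤ N ^ 4 := by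
            calc N * N = N ^ 2 := (pow_two N).symm
              _ ≤ N ^ 4 := Nat.pow_le_pow_right hN1 (by norm_num)
  · obtain ⟨-, hvan, -⟩ := hP n
    have hn1 : 0 < n := lt_of_lt_of_le (Nat.two_pow_pos k) hn
    have hk : k ≤ Nat.log 2 n := Nat.le_log_of_pow_le (by norm_num) hn
    obtain ⟨hfd, m, hm, g, hgc, hgd, hfg⟩ := hf
    exact hvan f ⟨hfd, m, hm.trans (Nat.pow_le_pow_right hn1 hk), g,
      hgc.trans (Nat.pow_le_pow_right hn1 hk), hgd.trans (Nat.pow_le_pow_right hn1 hk), hfg⟩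
  · obtain ⟨hlt, -⟩ := hn₀ n hn
    obtain ⟨-, -, hwit⟩ := hP n
    rw [hN n] at hwit
    exact hwit hlt

end Literature.Barriers.ValiantsHypothesis
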